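import Summits.Ventures.YMGap.Census.CubeDecomposition
import Summits.Ventures.YMGap.Census.CubeIntegral
import Summits.Ventures.YMGap.Census.PatternMonotone
import HarnessLib

/-!
# Venture YMGap, track (b) — the cube-pattern partition function factorises:
# `∫ ∏_{p ∈ S₀} f_c(U_p) dU = (1 + Σ_j d_j² c_j⁶)^{#cubes}` (Tomboulis, arXiv:0707.2179, App. A (A.4)–(A.5))

HONEST FRAMING: venture file of the cell `pub-ymgap` (QuantumFields programme), track (b); an exact finite Haar integral on
the torus `(ℤ/Lℤ)^d` (`L` even, `1 < L`); nothing about (5.15), limits, confinement or a mass gap.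

For the equal-parity cube pattern `S₀ = cubePattern (dirs3 i j k) (parClass i j k)` (the faces of the unit 3-cubes in the
directions `i < j < k` whose base points have equal `i, j, k`-parities; `CubeDecomposition`), the pattern field
`basePatternField c S₀` (`f_c` on `S₀`, `1` elsewhere; `PatternMonotone`) has the integrand `∏_{β ∈ cubeBases} cubeFn β`
(`coefFieldFn_basePatternField_cubePattern`), the cubes have pairwise disjoint link sets, so the integral factorises
(`integral_prod_eq_prod_integral`, independence of disjoint link blocks, `LatticeRP.integral_mul_eq_of_dependsOn`) and each
factor is the one-cube number `cubeZ = 1 + Σ_{n=1}^{J} (n+1)² c_n⁶` (`CubeIntegral.cubeZ_eq`):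
**`coefFieldZ_basePatternField_cubePattern`**.  This is (A.4)–(A.5) of Tomboulis's App. A with the integration done
exactly instead of bounded, on every even torus instead of `L = 2^m`.

References: E. T. Tomboulis, arXiv:0707.2179, App. A §1 [cite: Tomboulis2007Confinement, App. A (A.4)–(A.5)].
-/

noncomputable section

open MeasureTheory Finset
open scoped BigOperators
open Literature.MathematicalPhysics.QuantumLattice
open Literature.MathematicalPhysics.QuantumFieldTheory
open Literature.MathematicalPhysics.QuantumFieldTheory.Tomboulis2007
open Literature.MathematicalPhysics.QuantumFieldTheory.WilsonRP

namespace Summit.Ventures.YMGap.Census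

variable {d L : ℕ}

/-! ### Plumbing: functions of disjoint link blocks integrate independently -/

/-- `charSum J oneCoef = 1` (the trivial weight). -/
theorem charSum_oneCoef (J : ℕ) (r : ℝ) : charSum J oneCoef r = 1 := by
  rw [← stdCoef_scaleCoeff_zero (fun _ => 0), charSum_stdCoef, fR_scaleCoeff]
  ring

/-- Independence of two continuous real functions of disjoint link blocks (real form of
`LatticeRP.integral_mul_eq_of_dependsOn`). -/
theorem integral_mul_eq_of_dependsOn_real [NeZero L] (S T : Finset (Edge d L)) (hST : Disjoint S T)
    {f g : GaugeConfig d L SU2 → ℝ} (hf : Continuous f) (hg : Continuous g)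
    (hfS : DependsOn f (S : Set (Edge d L))) (hgT : DependsOn g (T : Set (Edge d L))) :
    ∫ U, f U * g U ∂(Measure.pi fun _ : Edge d L => haarProbability SU2) =
      (∫ U, f U ∂(Measure.pi fun _ : Edge d L => haarProbability SU2)) *
        ∫ U, g U ∂(Measure.pi fun _ : Edge d L => haarProbability SU2) := by
  haveI : SecondCountableTopology SU2 := secondCountableTopology_su2
  have h := LatticeRP.integral_mul_eq_of_dependsOn (haarProbability SU2) S T hST
    (f := fun U => (f U : ℂ)) (g := fun U => (g U : ℂ))
    (Complex.measurable_ofReal.comp hf.measurable) (Complex.measurable_ofReal.comp hg.measurable)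
    (fun x y hxy => by simp only [hfS hxy]) (fun x y hxy => by simp only [hgT hxy])
  simp only [← Complex.ofReal_mul, integral_complex_ofReal] at h
  exact_mod_cast h

/-- **Continuous functions of pairwise disjoint link blocks integrate independently**:
`∫ ∏_{x ∈ s} G_x dU = ∏_{x ∈ s} ∫ G_x dU`. -/
theorem integral_prod_eq_prod_integral [NeZero L] {κ : Type*} [DecidableEq κ] (F : κ → Finset (Edge d L))
    (G : κ → GaugeConfig d L SU2 → ℝ) (hF : ∀ x y, x ≠ y → Disjoint (F x) (F y)) (hG : ∀ x, Continuous (G x))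
    (s : Finset κ) (hGF : ∀ x ∈ s, DependsOn (G x) (F x : Set (Edge d L))) :
    ∫ U, ∏ x ∈ s, G x U ∂(Measure.pi fun _ : Edge d L => haarProbability SU2) =
      ∏ x ∈ s, ∫ U, G x U ∂(Measure.pi fun _ : Edge d L => haarProbability SU2) := by
  induction s using Finset.induction_on with
  | empty => simp
  | insert a s ha ih =>
    have hGFs : ∀ x ∈ s, DependsOn (G x) (F x : Set (Edge d L)) := fun x hx => hGF x (mem_insert_of_mem hx)
    simp only [prod_insert ha]
    rw [← ih hGFs]
    refine integral_mul_eq_of_dependsOn_real (F a) (s.biUnion F) ?_ (hG a) (continuous_finsetProd _ fun x _ => hG x)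
      (hGF a (mem_insert_self a s)) ?_
    · exact disjoint_biUnion_right _ _ _ |>.2 fun x hx => hF a x fun h => ha (h ▸ hx)
    · intro U V hUV
      exact prod_congr rfl fun x hx => hGFs x hx fun e he => hUV e (mem_coe.2 (mem_biUnion.2 ⟨x, hx, mem_coe.1 he⟩))

/-! ### The integrand of the cube pattern -/

section Pattern

variable {J : ℕ} {c : ℕ → ℝ} {i j k : Fin d}

/-- Two configurations agreeing on the four links of a plaquette have the same `Re tr U_p`. -/
theorem plaqRe_congr_links {U V : GaugeConfig d L SU2} (x : Site d L) {a a' : Fin d} (haa : a < a')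
    (h1 : U (x, a) = V (x, a)) (h2 : U (x.shift a, a') = V (x.shift a, a'))
    (h3 : U (x.shift a', a) = V (x.shift a', a)) (h4 : U (x, a') = V (x, a')) :
    plaqRe rhoFund U (x, ⟨(a, a'), haa⟩) = plaqRe rhoFund V (x, ⟨(a, a'), haa⟩) := by
  simp only [plaqRe, plaquetteHolonomy, h1, h2, h3, h4]

/-- **The cube weight depends only on the links of its own cube.** -/
theorem dependsOn_cubeFn [NeZero L] (hL : Even L) (hij : i < j) (hjk : j < k) {β : Site d L} (hβ : β ∈ cubeBases i j k) :
    DependsOn (cubeFn J c i j k β hij (hij.trans hjk) hjk) ((cubeFiber i j k β : Finset (Edge d L)) : Set (Edge d L)) := by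
  have hik := hij.trans hjk
  intro U V hUV
  have key : ∀ e : Edge d L, (e.2 = i ∨ e.2 = j ∨ e.2 = k) → linkBase i j k e = β → U e = V e :=
    fun e h1 h2 => hUV e (mem_coe.2 (mem_cubeFiber.2 ⟨h1, h2⟩))
  have oi : i = i ∨ i = j ∨ i = k := Or.inl rfl
  have oj : j = i ∨ j = j ∨ j = k := Or.inr (Or.inl rfl)
  have ok : k = i ∨ k = j ∨ k = k := Or.inr (Or.inr rfl)
  have l1 : U (β, i) = V (β, i) := key _ oi (linkBase_self hL hβ oi)
  have l2 : U (β, j) = V (β, j) := key _ oj (linkBase_self hL hβ oj)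
  have l3 : U (β, k) = V (β, k) := key _ ok (linkBase_self hL hβ ok)
  have l4 : U (β.shift i, j) = V (β.shift i, j) := key _ oj (linkBase_shift hL hβ oj oi hij.ne)
  have l5 : U (β.shift i, k) = V (β.shift i, k) := key _ ok (linkBase_shift hL hβ ok oi hik.ne)
  have l6 : U (β.shift j, i) = V (β.shift j, i) := key _ oi (linkBase_shift hL hβ oi oj hij.ne')
  have l7 : U (β.shift j, k) = V (β.shift j, k) := key _ ok (linkBase_shift hL hβ ok oj hjk.ne)
  have l8 : U (β.shift k, i) = V (β.shift k, i) := key _ oi (linkBase_shift hL hβ oi ok hik.ne')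
  have l9 : U (β.shift k, j) = V (β.shift k, j) := key _ oj (linkBase_shift hL hβ oj ok hjk.ne')
  have l10 : U ((β.shift k).shift i, j) = V ((β.shift k).shift i, j) :=
    key _ oj (linkBase_shift_shift hL hβ oj ok oi hjk.ne' hij.ne hik.ne')
  have l11 : U ((β.shift k).shift j, i) = V ((β.shift k).shift j, i) :=
    key _ oi (linkBase_shift_shift hL hβ oi ok oj hik.ne' hij.ne' hjk.ne')
  have l12 : U ((β.shift j).shift i, k) = V ((β.shift j).shift i, k) :=
    key _ ok (linkBase_shift_shift hL hβ ok oj oi hjk.ne hik.ne hij.ne')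
  have l13 : U ((β.shift j).shift k, i) = V ((β.shift j).shift k, i) :=
    key _ oi (linkBase_shift_shift hL hβ oi oj ok hij.ne' hik.ne' hjk.ne)
  have l14 : U ((β.shift i).shift j, k) = V ((β.shift i).shift j, k) :=
    key _ ok (linkBase_shift_shift hL hβ ok oi oj hik.ne hjk.ne hij.ne)
  have l15 : U ((β.shift i).shift k, j) = V ((β.shift i).shift k, j) :=
    key _ oj (linkBase_shift_shift hL hβ oj oi ok hij.ne hjk.ne' hik.ne)
  simp only [cubeFn]
  rw [plaqRe_congr_links β hij l1 l4 l6 l2, plaqRe_congr_links (β.shift k) hij l8 l10 l11 l9,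
    plaqRe_congr_links β (hij.trans hjk) l1 l5 l8 l3, plaqRe_congr_links (β.shift j) (hij.trans hjk) l6 l12 l13 l7,
    plaqRe_congr_links β hjk l2 l7 l9 l3, plaqRe_congr_links (β.shift i) hjk l4 l14 l15 l5]

/-- The cube weight is continuous. -/
theorem continuous_cubeFn (hij : i < j) (hik : i < k) (hjk : j < k) (β : Site d L) :
    Continuous (cubeFn J c i j k β hij hik hjk) := by
  have h : ∀ p : Plaquette d L, Continuous fun W : GaugeConfig d L SU2 => fR J c (plaqRe rhoFund W p) :=
    fun p => (continuous_fR J c).comp (continuous_plaqRe p)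
  unfold cubeFn
  exact (((((h _).mul (h _)).mul (h _)).mul (h _)).mul (h _)).mul (h _)

/-- The product of the plaquette functions over the six (distinct) faces of a cube is the cube weight. -/
theorem prod_cubeFaces_eq_cubeFn [Fact (1 < L)] (hij : i < j) (hjk : j < k) (β : Site d L) (W : GaugeConfig d L SU2) :
    ∏ p ∈ cubeFaces hij (hij.trans hjk) hjk β, fR J c (plaqRe rhoFund W p) = cubeFn J c i j k β hij (hij.trans hjk) hjk W := by
  have s1 := self_ne_shift' β i
  have s2 := self_ne_shift' β j
  have s3 := self_ne_shift' β k
  have nij := hij.ne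
  have njk := hjk.ne
  simp only [cubeFaces]
  rw [prod_insert, prod_insert, prod_insert, prod_insert, prod_insert, prod_singleton]
  · simp only [cubeFn]
    ring
  all_goals simp [s1, s2, s3, nij, njk, eq_comm]

/-- **The integrand of the cube-pattern field is the product of the cube weights.** -/
theorem coefFieldFn_basePatternField_cubePattern [NeZero L] [Fact (1 < L)] (hL : Even L) (hij : i < j) (hjk : j < k)
    (W : GaugeConfig d L SU2) :
    coefFieldFn J (basePatternField c (cubePattern (dirs3 i j k) (parClass i j k))) W =
      ∏ β ∈ cubeBases i j k, cubeFn J c i j k β hij (hij.trans hjk) hjk W := by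
  unfold coefFieldFn
  have h1 : ∀ p : Plaquette d L,
      charSum J (basePatternField c (cubePattern (dirs3 i j k) (parClass i j k)) p) (plaqRe rhoFund W p) =
        if p ∈ cubePattern (dirs3 i j k) (parClass i j k) then fR J c (plaqRe rhoFund W p) else 1 := by
    intro p
    unfold basePatternField
    split_ifs
    · exact charSum_stdCoef J c _
    · exact charSum_oneCoef J _
  simp_rw [h1]
  rw [Fintype.prod_ite_mem, cubePattern_eq_biUnion hL hij hjk, prod_biUnion (pairwiseDisjoint_cubeFaces hL hij hjk)]
  exact prod_congr rfl fun β _ => prod_cubeFaces_eq_cubeFn hij hjk β W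

/-- **`∫ ∏_{p ∈ S₀} f_c(U_p) dU = (1 + Σ_{n=1}^{J} (n+1)² c_n⁶)^{#cubes}`** for the equal-parity cube pattern `S₀`
(Tomboulis App. A (A.4)–(A.5), exactly, every even torus, every spin cut-off). -/
theorem coefFieldZ_basePatternField_cubePattern [NeZero L] [Fact (1 < L)] (hL : Even L) (J : ℕ) (c : ℕ → ℝ)
    (hij : i < j) (hjk : j < k) :
    coefFieldZ (L := L) J (basePatternField c (cubePattern (dirs3 i j k) (parClass i j k))) =
      (1 + ∑ n ∈ Icc 1 J, ((n : ℝ) + 1) ^ 2 * c n ^ 6) ^ (cubeBases (L := L) i j k).card := by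
  unfold coefFieldZ
  simp_rw [coefFieldFn_basePatternField_cubePattern hL hij hjk]
  rw [show LatticeRP.piMeasure (haarProbability SU2) = Measure.pi (fun _ : Edge d L => haarProbability SU2) from rfl,
    integral_prod_eq_prod_integral (cubeFiber i j k) (fun β => cubeFn J c i j k β hij (hij.trans hjk) hjk)
      (fun x y hxy => disjoint_cubeFiber i j k hxy) (fun β => continuous_cubeFn hij (hij.trans hjk) hjk β)
      (cubeBases i j k) (fun β hβ => dependsOn_cubeFn hL hij hjk hβ)]
  exact prod_eq_pow_card fun β _ => cubeZ_eq hij hjk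

end Pattern

end Summit.Ventures.YMGap.Census

end
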